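import Literature.Combinatorics.Designs.MannSubsquareObstruction
import Mathlib.GroupTheory.SpecificGroups.Dihedral

/-!
# MOLS(10) floor fact: the Cayley tables of the two groups of order 10 have no transversal, hence no orthogonal mate (kernel)
Framing: lottery ticket; floor = certified bounds/negative ranges.

Cell pub-namedobj (venture DiscreteObjects), target (M), designs gen 9.  Companion to `MannOrder10.lean` (the other classical
family of 10 × 10 Latin squares without an orthogonal mate).  The PARITY OBSTRUCTION (Euler 1779 for the cyclic square; Hall–Paige
1955 / Keedwell–Dénes, *Latin Squares and their Applications* (2015), Thm 2.5.5 and its Corollary: 'if G is an arbitrary group of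
order `n = 4k+2`, then G has no complete mapping', with Thm 1.5.1: complete mapping ⇔ transversal of the Cayley table):

* `not_bijective_diag_of_grading` — the core: if `f : ι → ZMod 2` is additive along `L` (`f (L i j) = f i + f j`) and takes the
  value `1` an ODD number of times, then for no bijection `τ` of the columns is `i ↦ L i (τ i)` a bijection (no transversal);
* `no_orthogonalMate_of_grading` — hence such an `L` has no orthogonal mate (`Literature…LatinSquares.IsOrthogonalMate`: the
  cells of a fixed symbol of a Latin mate would form a transversal);
* `no_orthogonalMate_mulTable` — for a finite group `G` with a surjective homomorphism onto `Multiplicative (ZMod 2)` and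
  `|G| ≡ 2 (mod 4)` the multiplication table `(g, h) ↦ g * h` has no orthogonal mate (Keedwell–Dénes, Cor. to Thm 2.5.5, in
  the case where the index-2 subgroup is given).
  -- TODO(general form): every group of order `4k+2` has a subgroup of index 2 (sign of the regular representation), so the
  -- hypothesis `φ` is automatic; not formalised here.
* order 10: `cyclicSquare10` (`(i, j) ↦ i + j` on `Fin 10`, the table of `Z₁₀`) and `dihedralSquare10` (the table of the
  dihedral group of order 10 in the ordering `r⁰ … r⁴, s r⁰ … s r⁴`; `dihedralSquare10_mul` identifies it with Mathlib's
  `DihedralGroup 5`) have NO orthogonal mate (`cyclicSquare10_no_orthogonalMate`, `dihedralSquare10_no_orthogonalMate`).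
Since `Z₁₀` and `D₅` are the only groups of order 10, no group-based Latin square of order 10 lies in a pair — let alone a
triple — of MOLS(10).  Classical; formalisation ours (replication of print, no novelty); no `sorry`; `decide` only on the two
explicit 10 × 10 tables.
-/

namespace Summit.Ventures.DiscreteObjects.MOLS

open Finset Literature.Combinatorics.Designs.LatinSquares

/-! ### The parity obstruction -/

section Parity

variable {ι : Type*} [Fintype ι]

/-- In `ZMod 2` every element is `0` or `1`, so a `ZMod 2`-valued sum counts the preimages of `1`. -/
theorem sum_zmod_two_eq_card (f : ι → ZMod 2) : ∑ i, f i = ((univ.filter fun i => f i = 1).card : ZMod 2) := by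
  rw [← sum_boole]
  refine sum_congr rfl fun i _ => ?_
  have h : ∀ x : ZMod 2, x = if x = 1 then 1 else 0 := by decide
  exact h (f i)

/-- **Parity obstruction (no transversal).**  If `f : ι → ZMod 2` is additive along the square `L` and takes the value `1`
an odd number of times, then for no bijection `τ` of the index set is the diagonal map `i ↦ L i (τ i)` bijective. -/
theorem not_bijective_diag_of_grading (L : ι → ι → ι) (f : ι → ZMod 2) (hf : ∀ i j, f (L i j) = f i + f j)
    (hodd : Odd (univ.filter fun i => f i = 1).card) {τ : ι → ι} (hτ : Function.Bijective τ) :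
    ¬ Function.Bijective fun i => L i (τ i) := by
  intro hη
  have h1 : ∑ i, f (L i (τ i)) = ∑ i, f i := hη.sum_comp f
  have h2 : ∑ i, f (τ i) = ∑ i, f i := hτ.sum_comp f
  have h3 : ∑ i, f (L i (τ i)) = ∑ i, f i + ∑ i, f (τ i) := by
    rw [← sum_add_distrib]
    exact sum_congr rfl fun i _ => hf i (τ i)
  have h22 : ∀ x : ZMod 2, x + x = 0 := by decide
  have h4 : ∑ i, f i = 0 := by rw [← h1, h3, h2, h22]
  rw [sum_zmod_two_eq_card, ZMod.natCast_eq_zero_iff] at h4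
  exact (Nat.not_even_iff_odd.mpr hodd) (even_iff_two_dvd.mpr h4)

/-- **Parity obstruction (no orthogonal mate).**  Under the same hypotheses `L` has no Latin orthogonal mate: the cells
carrying a fixed symbol of a mate would form a transversal. -/
theorem no_orthogonalMate_of_grading (L : ι → ι → ι) (f : ι → ZMod 2) (hf : ∀ i j, f (L i j) = f i + f j)
    (hodd : Odd (univ.filter fun i => f i = 1).card) {M : ι → ι → ι} (hM : IsLatinSquare M) :
    ¬ IsOrthogonalMate L M := by
  intro hLM
  -- a symbol `s` (the index set is nonempty since the odd count is positive)
  obtain ⟨s, -⟩ : ∃ s, s ∈ univ.filter fun i => f i = 1 := by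
    apply Finset.Nonempty.exists_mem
    rw [← card_pos]
    exact hodd.pos
  -- in each row the symbol `s` of `M` sits in exactly one column `τ i`
  have hrow : ∀ i, ∃ j, M i j = s := fun i => (Finite.injective_iff_bijective.mp (hM.1 i)).2 s
  choose τ hτ using hrow
  have τinj : Function.Injective τ := by
    intro i i' h
    have e : M i (τ i) = M i' (τ i) := by rw [hτ i, h, hτ i']
    exact hM.2 (τ i) e
  have τbij : Function.Bijective τ := Finite.injective_iff_bijective.mp τinj
  refine not_bijective_diag_of_grading L f hf hodd τbij (Finite.injective_iff_bijective.mp ?_)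
  intro i i' h
  have e := hLM (a₁ := (i, τ i)) (a₂ := (i', τ i')) (Prod.ext h (by simp only [hτ]))
  exact (Prod.ext_iff.mp e).1

/-- **Group form (Keedwell–Dénes 2015, Cor. to Thm 2.5.5, index-2 subgroup given).**  A finite group of order `≡ 2 (mod 4)`
with a homomorphism ONTO the group of order 2 has no complete mapping: its multiplication table has no orthogonal mate. -/
theorem no_orthogonalMate_mulTable {G : Type*} [Group G] [Fintype G]
    (φ : G →* Multiplicative (ZMod 2)) (hφ : Function.Surjective φ) (hcard : Fintype.card G % 4 = 2)
    {M : G → G → G} (hM : IsLatinSquare M) : ¬ IsOrthogonalMate (fun g h : G => g * h) M := by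
  classical
  refine no_orthogonalMate_of_grading _ (fun g => Multiplicative.toAdd (φ g)) (fun g h => by simp) ?_ hM
  -- the fibre of `1` has `|G| / 2` elements, an odd number
  have hfib := MonoidHom.card_fiber_eq_of_mem_range φ (x := Multiplicative.ofAdd 1) (y := Multiplicative.ofAdd 0)
    (hφ _) (hφ _)
  have hsplit : (univ.filter fun g => φ g = Multiplicative.ofAdd 1).card +
      (univ.filter fun g => φ g = Multiplicative.ofAdd 0).card = Fintype.card G := by
    rw [← card_union_of_disjoint, ← card_univ]
    · congr 1
      ext g
      simp only [mem_union, mem_filter, mem_univ, true_and, iff_true]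
      have h : ∀ x : Multiplicative (ZMod 2), x = Multiplicative.ofAdd 1 ∨ x = Multiplicative.ofAdd 0 := by decide
      exact h (φ g)
    · rw [disjoint_filter]
      intro g _ h1 h0
      rw [h1] at h0
      exact absurd h0 (by decide)
  have heq : (univ.filter fun g => Multiplicative.toAdd (φ g) = 1) = univ.filter fun g => φ g = Multiplicative.ofAdd 1 := by
    rfl
  rw [heq]
  rw [← hfib] at hsplit
  -- 2 · #fibre = |G| ≡ 2 (mod 4)
  rw [Nat.odd_iff]
  omega

end Parity

/-! ### Order 10: the cyclic and the dihedral square -/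

section OrderTen

/-- the cyclic Latin square of order 10, `(i, j) ↦ i + j (mod 10)` (Cayley table of `Z₁₀`) -/
def cyclicSquare10 : Fin 10 → Fin 10 → Fin 10 := fun i j => i + j

/-- parity of a residue mod 10 (well defined since `2 ∣ 10`) -/
def parity10 : Fin 10 → ZMod 2 := fun i => (i.val : ZMod 2)

/-- `cyclicSquare10` is a Latin square -/
theorem cyclicSquare10_isLatinSquare : IsLatinSquare cyclicSquare10 := by
  unfold IsLatinSquare cyclicSquare10 Function.Injective
  constructor <;> decide

/-- parity is additive along the cyclic square -/
theorem parity10_cyclic : ∀ i j, parity10 (cyclicSquare10 i j) = parity10 i + parity10 j := by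
  unfold parity10 cyclicSquare10; decide

/-- five residues mod 10 are odd -/
theorem parity10_odd_card : Odd (univ.filter fun i => parity10 i = 1).card := by
  unfold parity10; decide

/-- **The cyclic Latin square of order 10 has no orthogonal mate** (Euler 1779). -/
theorem cyclicSquare10_no_orthogonalMate {M : Fin 10 → Fin 10 → Fin 10} (hM : IsLatinSquare M) :
    ¬ IsOrthogonalMate cyclicSquare10 M :=
  no_orthogonalMate_of_grading cyclicSquare10 parity10 parity10_cyclic parity10_odd_card hM

/-- the Cayley table of the dihedral group of order 10 on `Fin 10`: index `5a + x` (`a ∈ {0,1}`, `x ∈ {0,…,4}`) stands for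
`sᵃ rˣ`, and `(sᵃ rˣ)(sᵇ rʸ) = s^(a+b) r^((-1)ᵇ x + y)` -/
def dihedralSquare10 : Fin 10 → Fin 10 → Fin 10 := fun i j =>
  ⟨((i.val / 5 + j.val / 5) % 2) * 5 + ((if j.val / 5 = 0 then i.val % 5 else (5 - i.val % 5) % 5) + j.val % 5) % 5,
    by omega⟩

/-- the reflection indicator: `0` on rotations (indices `< 5`), `1` on reflections -/
def refl10 : Fin 10 → ZMod 2 := fun i => ((i.val / 5 : ℕ) : ZMod 2)

/-- `dihedralSquare10` is a Latin square -/
theorem dihedralSquare10_isLatinSquare : IsLatinSquare dihedralSquare10 := by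
  unfold IsLatinSquare dihedralSquare10 Function.Injective
  constructor <;> decide

/-- the reflection indicator is additive along the dihedral square (rotations form a subgroup of index 2) -/
theorem refl10_dihedral : ∀ i j, refl10 (dihedralSquare10 i j) = refl10 i + refl10 j := by
  unfold refl10 dihedralSquare10; decide

/-- five of the ten elements are reflections -/
theorem refl10_odd_card : Odd (univ.filter fun i => refl10 i = 1).card := by
  unfold refl10; decide

/-- the labelling `Fin 10 → DihedralGroup 5`: `x ↦ r x` for `x < 5`, `5 + x ↦ sr x` -/
def toDihedral5 (i : Fin 10) : DihedralGroup 5 :=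
  if i.val / 5 = 0 then DihedralGroup.r (i.val % 5 : ℕ) else DihedralGroup.sr (i.val % 5 : ℕ)

/-- the labelling is injective (hence a bijection onto the group of order 10) -/
theorem toDihedral5_injective : Function.Injective toDihedral5 := by
  unfold toDihedral5 Function.Injective; decide

/-- `dihedralSquare10` IS the multiplication table of `DihedralGroup 5` under the labelling `toDihedral5` -/
theorem dihedralSquare10_mul : ∀ i j, toDihedral5 (dihedralSquare10 i j) = toDihedral5 i * toDihedral5 j := by
  unfold toDihedral5 dihedralSquare10; decide

/-- **The Cayley table of the dihedral group of order 10 has no orthogonal mate** (Hall–Paige 1955). -/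
theorem dihedralSquare10_no_orthogonalMate {M : Fin 10 → Fin 10 → Fin 10} (hM : IsLatinSquare M) :
    ¬ IsOrthogonalMate dihedralSquare10 M :=
  no_orthogonalMate_of_grading dihedralSquare10 refl10 refl10_dihedral refl10_odd_card hM

end OrderTen

/-! ### Isotopes (appended 2026-08-21, designs g9): group-BASED squares of order 10 -/

section Isotopy

variable {ι : Type*}

/-- **Having no Latin orthogonal mate is an isotopy invariant.**  If no Latin square is an orthogonal mate of `L`, the same
holds for every isotope `(i, j) ↦ γ (L (α i) (β j))` of `L` (rows, columns and symbols permuted). -/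
theorem no_orthogonalMate_of_isotopic {L : ι → ι → ι} (hL : ∀ M : ι → ι → ι, IsLatinSquare M → ¬ IsOrthogonalMate L M)
    (α β γ : Equiv.Perm ι) {M' : ι → ι → ι} (hM' : IsLatinSquare M') :
    ¬ IsOrthogonalMate (fun i j => γ (L (α i) (β j))) M' := by
  intro h
  refine hL (fun i j => M' (α.symm i) (β.symm j)) ⟨fun i => ?_, fun j => ?_⟩ ?_
  · exact (hM'.1 (α.symm i)).comp β.symm.injective
  · exact (hM'.2 (β.symm j)).comp α.symm.injective
  · rintro ⟨i, j⟩ ⟨i', j'⟩ hpq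
    simp only [Prod.mk.injEq] at hpq
    obtain ⟨hLij, hMij⟩ := hpq
    have e := @h (α.symm i, β.symm j) (α.symm i', β.symm j')
      (by simp only [Equiv.apply_symm_apply, Prod.mk.injEq]; exact ⟨by rw [hLij], hMij⟩)
    simp only [Prod.mk.injEq, EmbeddingLike.apply_eq_iff_eq] at e
    exact Prod.ext e.1 e.2

/-- **Every isotope of the cyclic square of order 10 has no orthogonal mate.** -/
theorem cyclicSquare10_isotope_no_orthogonalMate (α β γ : Equiv.Perm (Fin 10)) {M : Fin 10 → Fin 10 → Fin 10}
    (hM : IsLatinSquare M) : ¬ IsOrthogonalMate (fun i j => γ (cyclicSquare10 (α i) (β j))) M :=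
  no_orthogonalMate_of_isotopic (fun _ hM => cyclicSquare10_no_orthogonalMate hM) α β γ hM

/-- **Every isotope of the dihedral square of order 10 has no orthogonal mate.**  With the previous theorem: no GROUP-BASED
Latin square of order 10 (a square isotopic to the Cayley table of a group of order 10, i.e. of `Z₁₀` or `D₅`) has an orthogonal
mate (Keedwell–Dénes 2015, Cor. to Thm 2.5.5 with Thm 1.5.1, for `n = 10`). -/
theorem dihedralSquare10_isotope_no_orthogonalMate (α β γ : Equiv.Perm (Fin 10)) {M : Fin 10 → Fin 10 → Fin 10}
    (hM : IsLatinSquare M) : ¬ IsOrthogonalMate (fun i j => γ (dihedralSquare10 (α i) (β j))) M :=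
  no_orthogonalMate_of_isotopic (fun _ hM => dihedralSquare10_no_orthogonalMate hM) α β γ hM

end Isotopy

end Summit.Ventures.DiscreteObjects.MOLS
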